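import Literature.Combinatorics.Optimization.MaximumMatchingCover
import HarnessLib

/-!
# `α' ≥ δ` when `n ≥ 2δ` (Bondy–Murty Exercise 16.1.12)

Topic `Literature/Combinatorics/Optimization`, namespace `Literature.Combinatorics.Optimization`.
Lane `lit-hodgefound`, seat `lit-hodgefound-p32`, row gen33-#22. Theorems only (no `def`, no named
fact); sequel of `AugmentingPathMatching.lean` (gen33-#15: an `M`-augmenting path yields a larger
matching, Theorem 16.3) and `MaximumMatchingCover.lean` (gen33-#17: maximum matchings exist).

## The source, as printed

J. A. Bondy, U. S. R. Murty, *Graph Theory* (GTM 244), **Exercise 16.1.12** "Let `G` be a simple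
graph with `n ≥ 2δ`. Show that `α' ≥ δ`."  (`α'(G)` = the matching number, `δ` = the minimum
degree.)

## The proof formalised

Let `M` be a maximum matching and `U` the set of vertices it does not cover. If `|U| ≤ 1` then
`2|M| ≥ n − 1 ≥ 2δ − 1`, so `|M| ≥ δ`. Otherwise take `u ≠ u'` in `U`. No neighbour of `u` or `u'`
is uncovered (the edge could be added to `M`), and if `x ∈ N(u)` is matched by `M` to `y` then
`y ∉ N(u')` (else `u x y u'` is an `M`-augmenting path, Theorem 16.3); so the `M`-partners of
`N(u)` and the set `N(u')` are disjoint subsets of `V(M)`, whence `2δ ≤ d(u) + d(u') ≤ |V(M)| = 2|M|`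
(§ 1, `degree_add_degree_le_ncard_verts`), and `|M| ≥ δ` (§ 2,
`le_ncard_edgeSet_of_maximum_of_le_degree`, `exists_isMatching_le_ncard_edgeSet`).

## References

* [BondyMurty2008] J. A. Bondy, U. S. R. Murty, *Graph Theory*, GTM 244, Springer 2008,
  Exercise 16.1.12, Theorem 16.3.
-/

noncomputable section

open Finset SimpleGraph

namespace Literature.Combinatorics.Optimization

variable {V : Type*} [Fintype V] [DecidableEq V] (G : SimpleGraph V) [DecidableRel G.Adj]

/-! ### § 1 Two uncovered vertices of a maximum matching -/

omit [DecidableEq V] [DecidableRel G.Adj] in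
/-- **The vertices not covered by a maximum matching form a stable set**: an edge joining two of
them could be added. [cite: BondyMurty2008, §16.1 (maximal and maximum matchings)] -/
theorem not_adj_of_maximum_of_notMem (M : G.Subgraph) (hM : M.IsMatching)
    (hmax : ∀ M' : G.Subgraph, M'.IsMatching → M'.verts.ncard ≤ M.verts.ncard) {u u' : V}
    (hu : u ∉ M.verts) (hu' : u' ∉ M.verts) : ¬ G.Adj u u' := by
  intro hadj
  have hdisj : Disjoint M.support (G.subgraphOfAdj hadj).support := by
    rw [support_subgraphOfAdj, Set.disjoint_left]
    intro x hx hx'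
    have hxM := M.support_subset_verts hx
    rcases hx' with hxu | hxv
    · exact hu (hxu ▸ hxM)
    · exact hu' ((Set.mem_singleton_iff.mp hxv) ▸ hxM)
  have hle := hmax (M ⊔ G.subgraphOfAdj hadj)
    (hM.sup (Subgraph.IsMatching.subgraphOfAdj hadj) hdisj)
  rw [Subgraph.verts_sup, subgraphOfAdj_verts] at hle
  have hlt : M.verts.ncard < (M.verts ∪ {u, u'}).ncard :=
    Set.ncard_lt_ncard (Set.ssubset_iff_subset_ne.mpr ⟨Set.subset_union_left, fun h =>
      hu (h.symm ▸ Set.mem_union_right _ (Set.mem_insert _ _))⟩) (Set.toFinite _)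
  omega

omit [DecidableEq V] [DecidableRel G.Adj] in
/-- **No edge of a maximum matching `M` joins a neighbour of `u` to a neighbour of `u'`, for distinct
uncovered vertices `u, u'`**: `u x y u'` would be an `M`-augmenting path (Theorem 16.3).
[cite: BondyMurty2008, Theorem 16.3 (with Exercise 16.1.12)] -/
theorem not_adj_partner_of_maximum (M : G.Subgraph) (hM : M.IsMatching)
    (hmax : ∀ M' : G.Subgraph, M'.IsMatching → M'.verts.ncard ≤ M.verts.ncard) {u u' x y : V}
    (huu' : u ≠ u') (hu : u ∉ M.verts) (hu' : u' ∉ M.verts) (hux : G.Adj u x) (hxy : M.Adj x y) :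
    ¬ G.Adj y u' := by
  intro hyu'
  have hx : x ∈ M.verts := M.edge_vert hxy
  have hy : y ∈ M.verts := M.edge_vert hxy.symm
  -- the path `u x y u'`
  let p : G.Walk u u' := Walk.cons hux (Walk.cons (M.adj_sub hxy) (Walk.cons hyu' Walk.nil))
  have hsupp : p.support = [u, x, y, u'] := rfl
  have hlen : p.length = 2 * 1 + 1 := rfl
  have hp : p.IsPath := by
    rw [Walk.isPath_def, hsupp]
    have hux' : u ≠ x := fun h => hu (h ▸ hx)
    have huy : u ≠ y := fun h => hu (h ▸ hy)
    have hxu' : x ≠ u' := fun h => hu' (h ▸ hx)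
    have hyu'' : y ≠ u' := fun h => hu' (h ▸ hy)
    have hxy' : x ≠ y := (M.adj_sub hxy).ne
    simp [hux', huy, huu', hxu', hyu'', hxy']
  have hclosed : ∀ v ∈ p.support, ∀ w, M.Adj v w → w ∈ p.support := by
    intro v hv w hvw
    rw [hsupp] at hv ⊢
    simp only [List.mem_cons, List.not_mem_nil, or_false] at hv ⊢
    rcases hv with rfl | rfl | rfl | rfl
    · exact absurd (M.edge_vert hvw) hu
    · exact Or.inr (Or.inr (Or.inl ((hM hx).unique hvw hxy)))
    · exact Or.inr (Or.inl ((hM hy).unique hvw hxy.symm))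
    · exact absurd (M.edge_vert hvw) hu'
  obtain ⟨M', hM', hlt⟩ := not_maximum_of_augmenting G M hM p hp hlen hu hu' hclosed
  have := hmax M' hM'
  omega

omit [DecidableEq V] in
/-- **`d(u) + d(u') ≤ |V(M)|` for a maximum matching `M` and distinct uncovered vertices `u, u'`**:
the `M`-partners of `N(u)` and `N(u')` are disjoint subsets of `V(M)`.
[cite: BondyMurty2008, Exercise 16.1.12 (with Theorem 16.3)] -/
theorem degree_add_degree_le_ncard_verts (M : G.Subgraph) (hM : M.IsMatching)
    (hmax : ∀ M' : G.Subgraph, M'.IsMatching → M'.verts.ncard ≤ M.verts.ncard) {u u' : V}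
    (huu' : u ≠ u') (hu : u ∉ M.verts) (hu' : u' ∉ M.verts) :
    G.degree u + G.degree u' ≤ M.verts.ncard := by
  classical
  -- neighbours are covered
  have hNu : ∀ x, G.Adj u x → x ∈ M.verts := fun x hx => by
    by_contra h
    exact not_adj_of_maximum_of_notMem G M hM hmax hu h hx
  have hNu' : ∀ x, G.Adj u' x → x ∈ M.verts := fun x hx => by
    by_contra h
    exact not_adj_of_maximum_of_notMem G M hM hmax hu' h hx
  -- the partner map on `V(M)`
  have hex : ∀ v, v ∈ M.verts → ∃ w, M.Adj v w := fun v hv => (hM hv).exists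
  choose partner hpartner using hex
  set A : Finset V := (G.neighborFinset u).attach.image
    fun x => partner x.1 (hNu x.1 ((G.mem_neighborFinset u x.1).mp x.2)) with hA
  set B : Finset V := G.neighborFinset u' with hB
  have hAcard : A.card = G.degree u := by
    rw [hA, Finset.card_image_of_injOn, Finset.card_attach, card_neighborFinset_eq_degree]
    rintro ⟨x₁, hx₁⟩ - ⟨x₂, hx₂⟩ - h
    have h₁ := hpartner x₁ (hNu x₁ ((G.mem_neighborFinset u x₁).mp hx₁))
    have h₂ := hpartner x₂ (hNu x₂ ((G.mem_neighborFinset u x₂).mp hx₂))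
    simp only at h
    rw [h] at h₁
    exact Subtype.ext ((hM (M.edge_vert h₂.symm)).unique h₁.symm h₂.symm)
  have hdisj : Disjoint A B := by
    rw [Finset.disjoint_left]
    intro y hyA hyB
    rw [hA, Finset.mem_image] at hyA
    obtain ⟨⟨x, hx⟩, -, rfl⟩ := hyA
    rw [hB, mem_neighborFinset] at hyB
    exact not_adj_partner_of_maximum G M hM hmax huu' hu hu' ((G.mem_neighborFinset u x).mp hx)
      (hpartner x _) hyB.symm
  have hsub : A ∪ B ⊆ M.verts.toFinset := by
    intro y hy
    rw [Set.mem_toFinset]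
    rcases Finset.mem_union.mp hy with hyA | hyB
    · rw [hA, Finset.mem_image] at hyA
      obtain ⟨⟨x, hx⟩, -, rfl⟩ := hyA
      exact M.edge_vert (hpartner x _).symm
    · rw [hB, mem_neighborFinset] at hyB
      exact hNu' y hyB
  have h := Finset.card_le_card hsub
  rw [Finset.card_union_of_disjoint hdisj, hAcard, hB, card_neighborFinset_eq_degree,
    ← Set.ncard_eq_toFinset_card'] at h
  exact h

/-! ### § 2 Exercise 16.1.12 -/

omit [DecidableEq V] in
/-- **Exercise 16.1.12: if `n ≥ 2δ` then `α' ≥ δ`** — every maximum matching of a graph with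
minimum degree at least `δ` and at least `2δ` vertices has at least `δ` edges.
[cite: BondyMurty2008, Exercise 16.1.12] -/
theorem le_ncard_edgeSet_of_maximum_of_le_degree {δ : ℕ} (hδ : ∀ v, δ ≤ G.degree v)
    (hn : 2 * δ ≤ Fintype.card V) (M : G.Subgraph) (hM : M.IsMatching)
    (hmax : ∀ M' : G.Subgraph, M'.IsMatching → M'.verts.ncard ≤ M.verts.ncard) :
    δ ≤ M.edgeSet.ncard := by
  classical
  have h2 := ncard_verts_eq_two_mul_ncard_edgeSet G M hM
  have hU : (Set.univ \ M.verts).ncard + M.verts.ncard = Fintype.card V := by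
    rw [Set.ncard_sdiff_add_ncard_of_subset (Set.subset_univ _), Set.ncard_univ,
      Nat.card_eq_fintype_card]
  by_cases hlt : 1 < (Set.univ \ M.verts).ncard
  · -- two uncovered vertices
    obtain ⟨u, hu, u', hu', huu'⟩ := (Set.one_lt_ncard (Set.toFinite _)).mp hlt
    have h := degree_add_degree_le_ncard_verts G M hM hmax huu' hu.2 hu'.2
    have hdu := hδ u
    have hdu' := hδ u'
    omega
  · omega

omit [DecidableEq V] in
/-- **Exercise 16.1.12: if `n ≥ 2δ` then `α' ≥ δ`** — there is a matching with at least `δ` edges.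
[cite: BondyMurty2008, Exercise 16.1.12] -/
theorem exists_isMatching_le_ncard_edgeSet {δ : ℕ} (hδ : ∀ v, δ ≤ G.degree v)
    (hn : 2 * δ ≤ Fintype.card V) : ∃ M : G.Subgraph, M.IsMatching ∧ δ ≤ M.edgeSet.ncard := by
  obtain ⟨N, hN, hmax, -⟩ := exists_maximum_isMatching_verts_subset G (⊥ : G.Subgraph)
    (by intro v hv; simp at hv)
  exact ⟨N, hN, le_ncard_edgeSet_of_maximum_of_le_degree G hδ hn N hN hmax⟩

end Literature.Combinatorics.Optimization
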